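import Literature.MathematicalPhysics.QuantumFieldTheory.Balaban1983to89.Node00.OpsYRecordV11Reg335
import Literature.MathematicalPhysics.QuantumFieldTheory.Balaban1983to89.B9C2FormMajTorusLettersAtMemberY

/-!
# def-Y's v11 KNIT RECORD AT PRINT's THRESHOLD `M·α₀ ≤ a`: the regime rows of `Node00.OpsYRecordV11Reg335` in the N06 certificate's binder shape
# `∀ α₀, 0 < α₀ → M·α₀ ≤ a → ∀ U, (3.35) → …` over print's class `bg9YP` — Balaban, Commun. Math. Phys. **99** (1985) 389–434, (3.35) p.396 («we will need α₀ so
# small that O(1)Mα₀ is still a sufficiently small number»), (3.115) p.418, (3.122)–(3.138) pp.420–423, (3.152)–(3.153) p.426; Commun. Math. Phys. **98** (1985) 17–51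

[cite: Balaban1985BackgroundPropagators, (3.35) p.396, p.396 («O(1)Mα₀ … sufficiently small»), (3.115) p.418, (3.122)–(3.126) p.420, (3.128)–(3.129) p.421,
(3.132) p.422, (3.134) p.422, (3.138) p.423, (3.152)–(3.153) p.426, (3.124) p.420, p.420 («ω = (QGQ*)⁻¹B»), Thm 3.14 pp.426–427 (both sequences `{Ω_j}`, `{Ω′_j}`)]
[cite: Balaban1985Averaging, Prop. 2 p.26, (15)–(23) pp.19–21, (139)–(147) pp.39–40]

THE SHAPE.  The N06 certificate (dag-n06-d, `Summits/…/BalabanUVNodesN06AtOpsYNuOfRecordV6EPair*`) displays its regime-premised rows as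
`∀ x, M₁₂ ≤ (geo9Y x).M → ∀ α₀, 0 < α₀ → (geo9Y x).M * α₀ ≤ a → ∀ U : (bg9YP (M_N ℂ) SU(N) x).Cfg, (bg9YP …).Reg335 c α₀ U → (bg9YP …).Reg336 c α₀ U → <row>`
— print's «α₀ so small that O(1)Mα₀ is sufficiently small» keyed to ONE threshold `a`, with x-free numerics outside.  dag-n06-l's fold of the letter `hC2`
(`B9C2FormMajTorusLettersAtMemberY.c2FormMaj_c2YOfRecord`) is stated in exactly this shape (up to the unused `M₁₂ ≤ M` and `Reg336` antecedents), with the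
plaquette numerics UNFOLDED and member-free: `2(10La)(1+10La)e^{40La}·L⁴ < α₀′`, `L = ℓ₆ + 1` (`Kpl_mul_L4_eq`; inhabited by `B7Prop5WindowNumerics.hKa_b7W`).

THIS FILE restates def-Y's v11 knit record rows of `OpsYRecordV11Reg335` (there keyed to dag-n06-l's per-background binders `0 ≤ Mα₀`, `K_pl(Mα₀)·L⁴ < α₀′` and
`regQY G i c₀ α₀ U`) in that threshold shape, so that each certificate row of the KNIT edition is discharged by ONE application:

* §1 the two-line conversion kit (dag-n06-l's inline `have`s, named): `0 ≤ α₀ ⇒ 0 ≤ Mα₀` (`kGeo_M_mul_nonneg`), and `K_pl(a)·L⁴ < α₀′ ∧ 0 ≤ α₀ ∧ Mα₀ ≤ a ⇒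
  K_pl(Mα₀)·L⁴ < α₀′` (`Kpl_mul_L4_lt_of_thresh`, `K_pl` monotone: `Kpl_mono`); the first conjunct of print's member class is def-Y's regime of record
  (`regQY_of_reg335YP`: `(bg9YP _ G x).Reg335 c α₀ U → regQY G x.toKIdx c α₀ U`, i.e. (3.35) for `{Ω_j}`);
* §2 at general `G ≤ U(N)`: (L6) «`Q(U)` onto» (`surjective_qKnitOfRecord_of_thresh`), `Q†(U)` injective, and (3.115)'s `Q D G′_phys R = 0` at the threshold;
* §3 ∕ §4 ★★★ AT THE RECORD (`G := SU(N)`, print's class `bg9YP`, `𝔯 := resYOfRecordP`): `hsymD` (`lettersYOfRecordV11K_symmDG₁GG_SU_thresh[K]`),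
  the unit `(Q G₁ Q†)(U)` given (3.138) (`…_isUnit_QGQOfQY_G₁_SU_thresh[K]`), `Q(U)` onto ∕ `Q†(U)` injective (`qKnitOfRecord_surjective_SU_thresh[K]`,
  `qsKnitOfRecord_injective_SU_thresh[K]`), `hZ` (`qKnitOfRecord_hZ_SU_thresh[K]`), and (3.152) ∕ (3.124) given (3.138) (`lettersYOfRecordV11K_ids3152_SU_thresh[K]`)
  — §3 (`…K`) with the threshold numerics FOLDED per member, `Kpl x.toKIdx a * (kGeo x.toKIdx).L ^ 4 < α₀′` (the output of dag-n06-l g36's x-free witness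
  `B9Eq3115KnitLetterYNumerics.knitWindow_inhabited_le` at `i := x.toKIdx`), §4 with them UNFOLDED and member-free, `2(10La)(1+10La)e^{40La}·L⁴ < α₀′`
  (dag-n06-l g35's `c2FormMaj_c2YOfRecord` convention; `Kpl_mul_L4_eq`).

The numerics binders are dag-n06-l's x-free set, verbatim: `c₀ ≤ 10`; `0 < α₀′`; for the symmetric ∕ (3.115) ∕ (3.152) rows `C₀(d+1)·α₀′ ≤ 1/3`, `2α₀′ ≤ c₂′(d+1,L)`;
for the onto ∕ unit rows `α₀′ ≤ α_Q(d+1,L)`, `K(d+1,L)·α₀′ < 1` (`B9Eq3115KnitLetterYOnto.kCol`); and the threshold's `2(10La)(1+10La)e^{40La}·L⁴ < α₀′`.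

HONEST STATUS.  Bookkeeping (monotonicity of `K_pl`, `0 ≤ M`) over the landed rows of `OpsYRecordV11Reg335`; no estimate of [B9] is asserted here; (3.138)
(`Δ⁽¹⁾(U) > 0` ∕ `G₁⁻¹(U)` a unit) and print's units `c_f η = 1` stay displayed (`hΔ1 ∕ hM1`, `hcf`).  REMARK for the numerics witness of the knit edition: the window
`B7Prop5WindowNumerics.alpha0W` inhabits `C₀α ≤ ⅓`, `4α ≤ c₂′` and the threshold, but `K(d+1,L)·α₀′ < 1` is an ADDITIONAL smallness (of order `L^{d+4}·α₀′`), to be met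
by a smaller `α₀′` — every row here is stated for an arbitrary `α₀′`.  0 `sorry`.
-/

namespace Literature.MathematicalPhysics.QuantumFieldTheory.Balaban1983to89.Node00

open B6KLevelCensusIndexV1 (KIdx kGeo)
open B9PinMembersKLevelV1 (MemberY geo9Y)
open B7Prop2SpecialUnitary (specialUnitaryUnits specialUnitaryUnits_le_unitaryUnits)
open B7Prop2Explicit (C0 c2')
open B9C2FormBoxRegimeY (Kpl)
open B9C2FormMajTorusLettersAtMemberY (Kpl_mono kGeo_M_nonneg Kpl_mul_L4_eq)
open B9Eq316AveragingTransposeZd (alphaQ)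
open B9Eq3115KnitLetterYOnto (kCol)
open B9Thm311ReadingCoords (IsSymmTr PosDefTr)
open B9B8AveragingJunction (parKnitY)
open B9BackgroundsKLevelV1P (bg9KP bg9YP)
open OpsYQLetter (regQY qKnitOfRecord qsKnitOfRecord isNullOnQ_qKnitOfRecord)
open scoped Matrix Matrix.Norms.L2Operator

variable {d ℓ : ℕ} {hd : 1 ≤ d + 1} {hL : Odd (ℓ + 1) ∧ 1 < ℓ + 1} {b₀ b₁ : ℝ} {Mstar : ℕ}

/-! ## §1 The conversion kit: `0 ≤ Mα₀`, `K_pl(Mα₀)·L⁴ < α₀′` from the threshold, and (3.35) for `{Ω_j}` from print's member class -/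

section Kit

/-- `0 ≤ α₀ ⇒ 0 ≤ M·α₀` (`M = L·M_h ≥ 0`): dag-n06-l's binder `hMα` at the threshold. [cite: Balaban1985BackgroundPropagators, (3.35) p.396, bookkeeping] -/
theorem kGeo_M_mul_nonneg (i : KIdx d ℓ hd hL b₀ b₁) {α₀ : ℝ} (hα₀ : 0 ≤ α₀) : 0 ≤ (kGeo i).M * α₀ :=
  mul_nonneg (kGeo_M_nonneg i) hα₀

/-- `K_pl(a)·L⁴ < α₀′`, `0 ≤ α₀`, `M·α₀ ≤ a ⇒ K_pl(M·α₀)·L⁴ < α₀′` (`K_pl` is monotone on `t ≥ 0`): dag-n06-l's binder `hK` at the threshold.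
[cite: Balaban1985BackgroundPropagators, (3.35) p.396, p.396 («O(1)Mα₀ … sufficiently small»), bookkeeping] -/
theorem Kpl_mul_L4_lt_of_thresh (i : KIdx d ℓ hd hL b₀ b₁) {a α₀' α₀ : ℝ} (hKa : Kpl i a * (kGeo i).L ^ 4 < α₀') (hα₀ : 0 ≤ α₀)
    (hMa : (kGeo i).M * α₀ ≤ a) : Kpl i ((kGeo i).M * α₀) * (kGeo i).L ^ 4 < α₀' :=
  have hL4 : 0 ≤ (kGeo i).L ^ 4 := pow_nonneg (by rw [show (kGeo i).L = ((ℓ + 1 : ℕ) : ℝ) from rfl]; positivity) 4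
  lt_of_le_of_lt (mul_le_mul_of_nonneg_right (Kpl_mono i (kGeo_M_mul_nonneg i hα₀) hMa) hL4) hKa

variable {N : ℕ} {G : Subgroup (Matrix (Fin N) (Fin N) ℂ)ˣ}

/-- print's member class (3.35) (regular for `{Ω_j}` AND `{Ω′_j}`, `bg9YP`) gives def-Y's regime of record at the member's index (its `{Ω_j}` half).
[cite: Balaban1985BackgroundPropagators, (3.35) p.396, Thm 3.14 pp.426–427, bookkeeping] -/
theorem regQY_of_reg335YP (x : MemberY d ℓ hd hL b₀ b₁ Mstar) {c α₀ : ℝ} {U : CfgY (Matrix (Fin N) (Fin N) ℂ) x.toKIdx}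
    (h : (bg9YP (Matrix (Fin N) (Fin N) ℂ) G x).Reg335 c α₀ U) : regQY G x.toKIdx c α₀ U :=
  h.1

/-- … and print's threshold at a member reads on dag-n06-l's carrier: `(geo9Y x).M = (kGeo x.toKIdx).M` (both `L·M_h`). [cite: Balaban1985BackgroundPropagators, (3.35) p.396, bookkeeping] -/
theorem geo9Y_M_eq_kGeo_M (x : MemberY d ℓ hd hL b₀ b₁ Mstar) : (geo9Y x).M = (kGeo x.toKIdx).M := rfl

end Kit

/-! ## §2 At general `G ≤ U(N)`: (L6) onto, `Q†` injective and (3.115)'s `Q D G′_phys R = 0` at the threshold -/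

section General

variable {N : ℕ} [Nonempty (Fin N)] {θ : Stage3Params} {G : Subgroup (Matrix (Fin N) (Fin N) ℂ)ˣ}

/-- ★★ (L6) AT THE THRESHOLD: `Q(U) = qKnitOfRecord N θ i U` is surjective for `0 ≤ α₀`, `M·α₀ ≤ a`, `U` in the regime of record, under the x-free numerics
`c₀ ≤ 10`, `0 < α₀′ ≤ α_Q(d+1,L)`, `K_pl(a)·L⁴ < α₀′`, `K(d+1,L)·α₀′ < 1` (dag-n06-l's `QknitY_surjective_of_reg335P` through `OpsYRecordV11Reg335`).
[cite: Balaban1985BackgroundPropagators, p.420 («ω = (QGQ*)⁻¹B»), (3.35) p.396] [cite: Balaban1985Averaging, (139)–(147) pp.39–40] -/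
theorem surjective_qKnitOfRecord_of_thresh (hG1 : ∀ u : (Matrix (Fin N) (Fin N) ℂ)ˣ, u ∈ G → ‖(u : Matrix (Fin N) (Fin N) ℂ)‖ ≤ 1)
    (hGU : G ≤ B7Prop2Explicit.unitaryUnits (Matrix (Fin N) (Fin N) ℂ)) {c₀ : ℝ} (hc : c₀ ≤ 10) (i : KIdx θ.d₆ θ.ℓ₆ θ.hd' θ.hL' θ.b₀ θ.b₁)
    {a α₀' : ℝ} (hα' : 0 < α₀') (hαQ : α₀' ≤ alphaQ (θ.d₆ + 1) (θ.ℓ₆ + 1)) (hKa : Kpl i a * (kGeo i).L ^ 4 < α₀')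
    (hsmall : kCol (θ.d₆ + 1) (θ.ℓ₆ + 1) * α₀' < 1) {α₀ : ℝ} (hα₀ : 0 ≤ α₀) (hMa : (kGeo i).M * α₀ ≤ a)
    {U : CfgY (Matrix (Fin N) (Fin N) ℂ) i} (hU : regQY G i c₀ α₀ U) : Function.Surjective (qKnitOfRecord N θ i U) :=
  surjective_qKnitOfRecord_of_regQY hG1 hGU hc i (kGeo_M_mul_nonneg i hα₀) hα' hαQ (Kpl_mul_L4_lt_of_thresh i hKa hα₀ hMa) hsmall hU

/-- ★★ AT THE THRESHOLD: the adjoint letter `Q†(U) = qsKnitOfRecord N θ i U` is injective. [cite: Balaban1985BackgroundPropagators, (3.128) p.421, p.393, (3.35) p.396] [cite: Balaban1985Averaging, (139)–(147) pp.39–40] -/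
theorem injective_qsKnitOfRecord_of_thresh (hG1 : ∀ u : (Matrix (Fin N) (Fin N) ℂ)ˣ, u ∈ G → ‖(u : Matrix (Fin N) (Fin N) ℂ)‖ ≤ 1)
    (hGU : G ≤ B7Prop2Explicit.unitaryUnits (Matrix (Fin N) (Fin N) ℂ)) {c₀ : ℝ} (hc : c₀ ≤ 10) (i : KIdx θ.d₆ θ.ℓ₆ θ.hd' θ.hL' θ.b₀ θ.b₁)
    {a α₀' : ℝ} (hα' : 0 < α₀') (hαQ : α₀' ≤ alphaQ (θ.d₆ + 1) (θ.ℓ₆ + 1)) (hKa : Kpl i a * (kGeo i).L ^ 4 < α₀')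
    (hsmall : kCol (θ.d₆ + 1) (θ.ℓ₆ + 1) * α₀' < 1) {α₀ : ℝ} (hα₀ : 0 ≤ α₀) (hMa : (kGeo i).M * α₀ ≤ a)
    {U : CfgY (Matrix (Fin N) (Fin N) ℂ) i} (hU : regQY G i c₀ α₀ U) : Function.Injective (qsKnitOfRecord N θ i U) :=
  injective_qsKnitOfRecord_of_regQY hG1 hGU hc i (kGeo_M_mul_nonneg i hα₀) hα' hαQ (Kpl_mul_L4_lt_of_thresh i hKa hα₀ hMa) hsmall hU

/-- ★★ AT THE THRESHOLD: (3.115)'s `Q(U) D_U G′_phys(U) R(U) = 0` for print's averaging of record over print's knit transporter (dag-n06-l's theorem,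
`OpsYQLetter.isNullOnQ_qKnitOfRecord`), numerics `c₀ ≤ 10`, `0 < α₀′`, `C₀α₀′ ≤ 1/3`, `2α₀′ ≤ c₂′`, `K_pl(a)·L⁴ < α₀′`.
[cite: Balaban1985BackgroundPropagators, (3.115) p.418, (3.121) p.419, (3.122)–(3.125) p.420, (3.35) p.396] [cite: Balaban1985Averaging, Prop. 2 p.26] -/
theorem qKnitOfRecord_hZ_of_thresh (hG1 : ∀ u : (Matrix (Fin N) (Fin N) ℂ)ˣ, u ∈ G → ‖(u : Matrix (Fin N) (Fin N) ℂ)‖ ≤ 1)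
    (hGU : G ≤ B7Prop2Explicit.unitaryUnits (Matrix (Fin N) (Fin N) ℂ)) {c₀ : ℝ} (hc : c₀ ≤ 10) (i : KIdx θ.d₆ θ.ℓ₆ θ.hd' θ.hL' θ.b₀ θ.b₁)
    {a α₀' : ℝ} (hα' : 0 < α₀') (hα3 : C0 (θ.d₆ + 1) * α₀' ≤ 1 / 3) (hα2 : 2 * α₀' ≤ c2' (θ.d₆ + 1) (θ.ℓ₆ + 1)) (hKa : Kpl i a * (kGeo i).L ^ 4 < α₀')
    {α₀ : ℝ} (hα₀ : 0 ≤ α₀) (hMa : (kGeo i).M * α₀ ≤ a) {U : CfgY (Matrix (Fin N) (Fin N) ℂ) i} (hU : regQY G i c₀ α₀ U) :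
    qKnitOfRecord N θ i U ∘ₗ gradY i U ∘ₗ GpPhysY i (parKnitY i) U ∘ₗ RY i (parKnitY i) (GpPhysY i (parKnitY i)) U = 0 :=
  isNullOnQ_qKnitOfRecord hG1 hGU hc i (kGeo_M_mul_nonneg i hα₀) hα' hα3 hα2 (Kpl_mul_L4_lt_of_thresh i hKa hα₀ hMa) U hU

end General

/-! ## §3 AT THE RECORD with the threshold numerics FOLDED per member: `K_pl(a)·L⁴ < α₀′` at `x.toKIdx` (dag-n06-l g36's x-free witness
`B9Eq3115KnitLetterYNumerics.knitWindow_inhabited_le` emits `∀ i a, 0 ≤ a → a ≤ a₁ → Kpl i a * (kGeo i).L ^ 4 < α₀′`, instantiated at `i := x.toKIdx`) -/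

section AtRecordThreshK

variable (N : ℕ) [Nonempty (Fin N)] (θ : Stage3Params) (Mstar : ℕ)

/-- ★★★ the knit certificate's `hsymD` row, threshold numerics folded (`hKa : Kpl x.toKIdx a * (kGeo x.toKIdx).L ^ 4 < α₀′`).
[cite: Balaban1985BackgroundPropagators, (3.122) p.420, (3.128) p.421, (3.134) p.422, (3.153) p.426, (3.35) p.396] [cite: Balaban1985Averaging, Prop. 2 p.26, (15) p.19] -/
theorem lettersYOfRecordV11K_symmDG₁GG_SU_threshK (x : MemberY θ.d₆ θ.ℓ₆ θ.hd' θ.hL' θ.b₀ θ.b₁ Mstar) {c₀ : ℝ} (hc : c₀ ≤ 10) {a α₀' : ℝ} (hα' : 0 < α₀')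
    (hα3 : C0 (θ.d₆ + 1) * α₀' ≤ 1 / 3) (hα2 : 2 * α₀' ≤ c2' (θ.d₆ + 1) (θ.ℓ₆ + 1)) (hKa : Kpl x.toKIdx a * (kGeo x.toKIdx).L ^ 4 < α₀') :
    ∀ α₀ : ℝ, 0 < α₀ → (geo9Y x).M * α₀ ≤ a → ∀ U : CfgY (Matrix (Fin N) (Fin N) ℂ) x.toKIdx,
      (bg9YP (Matrix (Fin N) (Fin N) ℂ) (specialUnitaryUnits (Fin N)) x).Reg335 c₀ α₀ U →
        IsSymmTr (fun _ => (1 : ℝ)) ((lettersYOfRecordV11K N θ Mstar (resYOfRecordP N θ Mstar) x).GD U) ∧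
          IsSymmTr (fun _ => (1 : ℝ)) ((lettersYOfRecordV11K N θ Mstar (resYOfRecordP N θ Mstar) x).G₁ U) ∧
            IsSymmTr (fun _ => (1 : ℝ)) ((lettersYOfRecordV11K N θ Mstar (resYOfRecordP N θ Mstar) x).GG U) :=
  fun _ hα₀ hMa _ hreg =>
    lettersYOfRecordV11K_symmDG₁GG_SU_of_regQY N θ Mstar hc x (kGeo_M_mul_nonneg x.toKIdx hα₀.le) hα' hα3 hα2
      (Kpl_mul_L4_lt_of_thresh x.toKIdx hKa hα₀.le hMa) (regQY_of_reg335YP x hreg)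

/-- ★★★ the knit certificate's unit `(Q G₁ Q†)(U)` row from (3.138), threshold numerics folded.
[cite: Balaban1985BackgroundPropagators, (3.132) p.422, (3.138) p.423, p.420 («ω = (QGQ*)⁻¹B»), (3.35) p.396] [cite: Balaban1985Averaging, (139)–(147) pp.39–40] -/
theorem lettersYOfRecordV11K_isUnit_QGQOfQY_G₁_SU_threshK (x : MemberY θ.d₆ θ.ℓ₆ θ.hd' θ.hL' θ.b₀ θ.b₁ Mstar) {c₀ : ℝ} (hc : c₀ ≤ 10) {a α₀' : ℝ}
    (hα' : 0 < α₀') (hαQ : α₀' ≤ alphaQ (θ.d₆ + 1) (θ.ℓ₆ + 1)) (hKa : Kpl x.toKIdx a * (kGeo x.toKIdx).L ^ 4 < α₀')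
    (hsmall : kCol (θ.d₆ + 1) (θ.ℓ₆ + 1) * α₀' < 1) :
    ∀ α₀ : ℝ, 0 < α₀ → (geo9Y x).M * α₀ ≤ a → ∀ U : CfgY (Matrix (Fin N) (Fin N) ℂ) x.toKIdx,
      (bg9YP (Matrix (Fin N) (Fin N) ℂ) (specialUnitaryUnits (Fin N)) x).Reg335 c₀ α₀ U →
        PosDefTr (fun _ => (1 : ℝ)) (deltaOneQY x.toKIdx (qKnitOfRecord N θ x.toKIdx) (qsKnitOfRecord N θ x.toKIdx) (parKnitY x.toKIdx)
          (GpPhysY x.toKIdx (parKnitY x.toKIdx)) (resYOfRecordP N θ Mstar x).Δ2 U) →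
        IsUnit (QGQOfQY x.toKIdx (qKnitOfRecord N θ x.toKIdx) (qsKnitOfRecord N θ x.toKIdx)
          (lettersYOfRecordV11K N θ Mstar (resYOfRecordP N θ Mstar) x).G₁ U) :=
  fun _ hα₀ hMa _ hreg hΔ1 =>
    lettersYOfRecordV11K_isUnit_QGQOfQY_G₁_SU_of_regQY N θ Mstar hc x (kGeo_M_mul_nonneg x.toKIdx hα₀.le) hα' hαQ
      (Kpl_mul_L4_lt_of_thresh x.toKIdx hKa hα₀.le hMa) hsmall (regQY_of_reg335YP x hreg) hΔ1

/-- ★★ the knit certificate's «`Q(U)` onto» row, threshold numerics folded. [cite: Balaban1985BackgroundPropagators, p.420, (3.35) p.396] [cite: Balaban1985Averaging, (139)–(147) pp.39–40] -/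
theorem qKnitOfRecord_surjective_SU_threshK (x : MemberY θ.d₆ θ.ℓ₆ θ.hd' θ.hL' θ.b₀ θ.b₁ Mstar) {c₀ : ℝ} (hc : c₀ ≤ 10) {a α₀' : ℝ}
    (hα' : 0 < α₀') (hαQ : α₀' ≤ alphaQ (θ.d₆ + 1) (θ.ℓ₆ + 1)) (hKa : Kpl x.toKIdx a * (kGeo x.toKIdx).L ^ 4 < α₀')
    (hsmall : kCol (θ.d₆ + 1) (θ.ℓ₆ + 1) * α₀' < 1) :
    ∀ α₀ : ℝ, 0 < α₀ → (geo9Y x).M * α₀ ≤ a → ∀ U : CfgY (Matrix (Fin N) (Fin N) ℂ) x.toKIdx,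
      (bg9YP (Matrix (Fin N) (Fin N) ℂ) (specialUnitaryUnits (Fin N)) x).Reg335 c₀ α₀ U → Function.Surjective (qKnitOfRecord N θ x.toKIdx U) :=
  fun _ hα₀ hMa _ hreg =>
    surjective_qKnitOfRecord_of_thresh unitBddY_specialUnitaryUnits specialUnitaryUnits_le_unitaryUnits hc x.toKIdx hα' hαQ hKa hsmall hα₀.le hMa
      (regQY_of_reg335YP x hreg)

/-- ★★ the knit certificate's «`Q†(U)` injective» row, threshold numerics folded. [cite: Balaban1985BackgroundPropagators, (3.128) p.421, p.393, (3.35) p.396] [cite: Balaban1985Averaging, (139)–(147) pp.39–40] -/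
theorem qsKnitOfRecord_injective_SU_threshK (x : MemberY θ.d₆ θ.ℓ₆ θ.hd' θ.hL' θ.b₀ θ.b₁ Mstar) {c₀ : ℝ} (hc : c₀ ≤ 10) {a α₀' : ℝ}
    (hα' : 0 < α₀') (hαQ : α₀' ≤ alphaQ (θ.d₆ + 1) (θ.ℓ₆ + 1)) (hKa : Kpl x.toKIdx a * (kGeo x.toKIdx).L ^ 4 < α₀')
    (hsmall : kCol (θ.d₆ + 1) (θ.ℓ₆ + 1) * α₀' < 1) :
    ∀ α₀ : ℝ, 0 < α₀ → (geo9Y x).M * α₀ ≤ a → ∀ U : CfgY (Matrix (Fin N) (Fin N) ℂ) x.toKIdx,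
      (bg9YP (Matrix (Fin N) (Fin N) ℂ) (specialUnitaryUnits (Fin N)) x).Reg335 c₀ α₀ U → Function.Injective (qsKnitOfRecord N θ x.toKIdx U) :=
  fun _ hα₀ hMa _ hreg =>
    injective_qsKnitOfRecord_of_thresh unitBddY_specialUnitaryUnits specialUnitaryUnits_le_unitaryUnits hc x.toKIdx hα' hαQ hKa hsmall hα₀.le hMa
      (regQY_of_reg335YP x hreg)

/-- ★★★ the knit certificate's `hZ` row, threshold numerics folded. [cite: Balaban1985BackgroundPropagators, (3.115) p.418, (3.121) p.419, (3.122)–(3.125) p.420, (3.35) p.396] [cite: Balaban1985Averaging, Prop. 2 p.26] -/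
theorem qKnitOfRecord_hZ_SU_threshK (x : MemberY θ.d₆ θ.ℓ₆ θ.hd' θ.hL' θ.b₀ θ.b₁ Mstar) {c₀ : ℝ} (hc : c₀ ≤ 10) {a α₀' : ℝ} (hα' : 0 < α₀')
    (hα3 : C0 (θ.d₆ + 1) * α₀' ≤ 1 / 3) (hα2 : 2 * α₀' ≤ c2' (θ.d₆ + 1) (θ.ℓ₆ + 1)) (hKa : Kpl x.toKIdx a * (kGeo x.toKIdx).L ^ 4 < α₀') :
    ∀ α₀ : ℝ, 0 < α₀ → (geo9Y x).M * α₀ ≤ a → ∀ U : CfgY (Matrix (Fin N) (Fin N) ℂ) x.toKIdx,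
      (bg9YP (Matrix (Fin N) (Fin N) ℂ) (specialUnitaryUnits (Fin N)) x).Reg335 c₀ α₀ U →
        qKnitOfRecord N θ x.toKIdx U ∘ₗ gradY x.toKIdx U ∘ₗ GpPhysY x.toKIdx (parKnitY x.toKIdx) U ∘ₗ
          RY x.toKIdx (parKnitY x.toKIdx) (GpPhysY x.toKIdx (parKnitY x.toKIdx)) U = 0 :=
  fun _ hα₀ hMa _ hreg =>
    qKnitOfRecord_hZ_of_thresh unitBddY_specialUnitaryUnits specialUnitaryUnits_le_unitaryUnits hc x.toKIdx hα' hα3 hα2 hKa hα₀.le hMa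
      (regQY_of_reg335YP x hreg)

/-- ★★★ the knit certificate's (3.152) ∕ (3.124) row from (3.138), threshold numerics folded.
[cite: Balaban1985BackgroundPropagators, (3.152) p.426, (3.124) p.420, (3.115) p.418, (3.138) p.423, (3.24)–(3.25) p.394, (3.35) p.396] [cite: Balaban1985Averaging, Prop. 2 p.26, (15) p.19] -/
theorem lettersYOfRecordV11K_ids3152_SU_threshK (𝔯 : ResY N θ Mstar) (x : MemberY θ.d₆ θ.ℓ₆ θ.hd' θ.hL' θ.b₀ θ.b₁ Mstar) {c₀ : ℝ} (hc : c₀ ≤ 10)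
    {a α₀' : ℝ} (hα' : 0 < α₀') (hα3 : C0 (θ.d₆ + 1) * α₀' ≤ 1 / 3) (hα2 : 2 * α₀' ≤ c2' (θ.d₆ + 1) (θ.ℓ₆ + 1))
    (hKa : Kpl x.toKIdx a * (kGeo x.toKIdx).L ^ 4 < α₀') (hcf : x.toKIdx.cf * etaS x.toKIdx = 1) :
    ∀ α₀ : ℝ, 0 < α₀ → (geo9Y x).M * α₀ ≤ a → ∀ U : CfgY (Matrix (Fin N) (Fin N) ℂ) x.toKIdx,
      (bg9YP (Matrix (Fin N) (Fin N) ℂ) (specialUnitaryUnits (Fin N)) x).Reg335 c₀ α₀ U →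
        IsUnit (deltaOneQY x.toKIdx (qKnitOfRecord N θ x.toKIdx) (qsKnitOfRecord N θ x.toKIdx) (parKnitY x.toKIdx) (GpPhysY x.toKIdx (parKnitY x.toKIdx))
          (𝔯 x).Δ2 U) →
        (RY x.toKIdx (parKnitY x.toKIdx) (GpPhysY x.toKIdx (parKnitY x.toKIdx)) U ∘ₗ divY x.toKIdx U ∘ₗ (lettersYOfRecordV11K N θ Mstar 𝔯 x).G₁ U
            = RY x.toKIdx (parKnitY x.toKIdx) (GpPhysY x.toKIdx (parKnitY x.toKIdx)) U ∘ₗ GpPhysY x.toKIdx (parKnitY x.toKIdx) U ∘ₗ divY x.toKIdx U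
        ∧ (lettersYOfRecordV11K N θ Mstar 𝔯 x).G₁ U ∘ₗ gradY x.toKIdx U ∘ₗ RY x.toKIdx (parKnitY x.toKIdx) (GpPhysY x.toKIdx (parKnitY x.toKIdx)) U
            = gradY x.toKIdx U ∘ₗ GpPhysY x.toKIdx (parKnitY x.toKIdx) U ∘ₗ RY x.toKIdx (parKnitY x.toKIdx) (GpPhysY x.toKIdx (parKnitY x.toKIdx)) U
        ∧ qKnitOfRecord N θ x.toKIdx U ∘ₗ (lettersYOfRecordV11K N θ Mstar 𝔯 x).G₁ U ∘ₗ gradY x.toKIdx U ∘ₗ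
              RY x.toKIdx (parKnitY x.toKIdx) (GpPhysY x.toKIdx (parKnitY x.toKIdx)) U = 0
        ∧ RY x.toKIdx (parKnitY x.toKIdx) (GpPhysY x.toKIdx (parKnitY x.toKIdx)) U ∘ₗ divY x.toKIdx U ∘ₗ (lettersYOfRecordV11K N θ Mstar 𝔯 x).G₁ U ∘ₗ
              qsKnitOfRecord N θ x.toKIdx U = 0
        ∧ RY x.toKIdx (parKnitY x.toKIdx) (GpPhysY x.toKIdx (parKnitY x.toKIdx)) U ∘ₗ divY x.toKIdx U ∘ₗ (lettersYOfRecordV11K N θ Mstar 𝔯 x).G₁ U ∘ₗ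
              gradY x.toKIdx U ∘ₗ RY x.toKIdx (parKnitY x.toKIdx) (GpPhysY x.toKIdx (parKnitY x.toKIdx)) U
            = RY x.toKIdx (parKnitY x.toKIdx) (GpPhysY x.toKIdx (parKnitY x.toKIdx)) U) :=
  fun _ hα₀ hMa _ hreg hM1 =>
    lettersYOfRecordV11K_ids3152_SU_of_regQY N θ Mstar 𝔯 hc x (kGeo_M_mul_nonneg x.toKIdx hα₀.le) hα' hα3 hα2
      (Kpl_mul_L4_lt_of_thresh x.toKIdx hKa hα₀.le hMa) hcf (regQY_of_reg335YP x hreg) hM1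

end AtRecordThreshK

/-! ## §4 ★★★ AT THE RECORD with the threshold numerics UNFOLDED and member-free (dag-n06-l g35's `c2FormMaj_c2YOfRecord` convention): the knit certificate's rows, one application each -/

section AtRecordThresh

variable (N : ℕ) [Nonempty (Fin N)] (θ : Stage3Params) (Mstar : ℕ)

/-- ★★★ **THE KNIT CERTIFICATE's `hsymD` ROW**: `∀ α₀, 0 < α₀ → M·α₀ ≤ a → ∀ U, (3.35) → G̃ ∧ G₁ ∧ 𝔊 symmetric` for the v11 knit record at `G := SU(N)`,
`𝔯 := resYOfRecordP N θ Mstar`, under the member-free numerics `c₀ ≤ 10`, `0 < α₀′`, `C₀(d+1)α₀′ ≤ 1/3`, `2α₀′ ≤ c₂′(d+1,L)`, `2(10La)(1+10La)e^{40La}·L⁴ < α₀′`.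
[cite: Balaban1985BackgroundPropagators, (3.122) p.420, (3.128) p.421, (3.134) p.422, (3.153) p.426, (3.35) p.396, p.396 («O(1)Mα₀ … small»)] [cite: Balaban1985Averaging, Prop. 2 p.26, (15) p.19] -/
theorem lettersYOfRecordV11K_symmDG₁GG_SU_thresh (x : MemberY θ.d₆ θ.ℓ₆ θ.hd' θ.hL' θ.b₀ θ.b₁ Mstar) {c₀ : ℝ} (hc : c₀ ≤ 10) {a α₀' : ℝ} (hα' : 0 < α₀')
    (hα3 : C0 (θ.d₆ + 1) * α₀' ≤ 1 / 3) (hα2 : 2 * α₀' ≤ c2' (θ.d₆ + 1) (θ.ℓ₆ + 1))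
    (hKa : 2 * (10 * ((θ.ℓ₆ : ℝ) + 1) * a) * (1 + 10 * ((θ.ℓ₆ : ℝ) + 1) * a) * Real.exp (4 * (10 * ((θ.ℓ₆ : ℝ) + 1) * a)) * ((θ.ℓ₆ : ℝ) + 1) ^ 4 < α₀') :
    ∀ α₀ : ℝ, 0 < α₀ → (geo9Y x).M * α₀ ≤ a → ∀ U : CfgY (Matrix (Fin N) (Fin N) ℂ) x.toKIdx,
      (bg9YP (Matrix (Fin N) (Fin N) ℂ) (specialUnitaryUnits (Fin N)) x).Reg335 c₀ α₀ U →
        IsSymmTr (fun _ => (1 : ℝ)) ((lettersYOfRecordV11K N θ Mstar (resYOfRecordP N θ Mstar) x).GD U) ∧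
          IsSymmTr (fun _ => (1 : ℝ)) ((lettersYOfRecordV11K N θ Mstar (resYOfRecordP N θ Mstar) x).G₁ U) ∧
            IsSymmTr (fun _ => (1 : ℝ)) ((lettersYOfRecordV11K N θ Mstar (resYOfRecordP N θ Mstar) x).GG U) :=
  fun _ hα₀ hMa _ hreg =>
    lettersYOfRecordV11K_symmDG₁GG_SU_of_regQY N θ Mstar hc x (kGeo_M_mul_nonneg x.toKIdx hα₀.le) hα' hα3 hα2
      (Kpl_mul_L4_lt_of_thresh x.toKIdx (by rw [Kpl_mul_L4_eq θ Mstar x a]; exact hKa) hα₀.le hMa) (regQY_of_reg335YP x hreg)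

/-- ★★★ **THE KNIT CERTIFICATE's UNIT `(Q G₁ Q†)(U)` ROW FROM (3.138)**: `∀ α₀, 0 < α₀ → M·α₀ ≤ a → ∀ U, (3.35) → Δ⁽¹⁾(U) > 0 → (Q G₁ Q†)(U)` a unit, at
`G := SU(N)`, `𝔯 := resYOfRecordP`, numerics `c₀ ≤ 10`, `0 < α₀′ ≤ α_Q(d+1,L)`, `2(10La)(1+10La)e^{40La}·L⁴ < α₀′`, `K(d+1,L)·α₀′ < 1`.
[cite: Balaban1985BackgroundPropagators, (3.132) p.422, (3.138) p.423, p.420 («ω = (QGQ*)⁻¹B»), (3.35) p.396] [cite: Balaban1985Averaging, (139)–(147) pp.39–40] -/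
theorem lettersYOfRecordV11K_isUnit_QGQOfQY_G₁_SU_thresh (x : MemberY θ.d₆ θ.ℓ₆ θ.hd' θ.hL' θ.b₀ θ.b₁ Mstar) {c₀ : ℝ} (hc : c₀ ≤ 10) {a α₀' : ℝ}
    (hα' : 0 < α₀') (hαQ : α₀' ≤ alphaQ (θ.d₆ + 1) (θ.ℓ₆ + 1))
    (hKa : 2 * (10 * ((θ.ℓ₆ : ℝ) + 1) * a) * (1 + 10 * ((θ.ℓ₆ : ℝ) + 1) * a) * Real.exp (4 * (10 * ((θ.ℓ₆ : ℝ) + 1) * a)) * ((θ.ℓ₆ : ℝ) + 1) ^ 4 < α₀')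
    (hsmall : kCol (θ.d₆ + 1) (θ.ℓ₆ + 1) * α₀' < 1) :
    ∀ α₀ : ℝ, 0 < α₀ → (geo9Y x).M * α₀ ≤ a → ∀ U : CfgY (Matrix (Fin N) (Fin N) ℂ) x.toKIdx,
      (bg9YP (Matrix (Fin N) (Fin N) ℂ) (specialUnitaryUnits (Fin N)) x).Reg335 c₀ α₀ U →
        PosDefTr (fun _ => (1 : ℝ)) (deltaOneQY x.toKIdx (qKnitOfRecord N θ x.toKIdx) (qsKnitOfRecord N θ x.toKIdx) (parKnitY x.toKIdx)
          (GpPhysY x.toKIdx (parKnitY x.toKIdx)) (resYOfRecordP N θ Mstar x).Δ2 U) →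
        IsUnit (QGQOfQY x.toKIdx (qKnitOfRecord N θ x.toKIdx) (qsKnitOfRecord N θ x.toKIdx)
          (lettersYOfRecordV11K N θ Mstar (resYOfRecordP N θ Mstar) x).G₁ U) :=
  fun _ hα₀ hMa _ hreg hΔ1 =>
    lettersYOfRecordV11K_isUnit_QGQOfQY_G₁_SU_of_regQY N θ Mstar hc x (kGeo_M_mul_nonneg x.toKIdx hα₀.le) hα' hαQ
      (Kpl_mul_L4_lt_of_thresh x.toKIdx (by rw [Kpl_mul_L4_eq θ Mstar x a]; exact hKa) hα₀.le hMa) hsmall (regQY_of_reg335YP x hreg) hΔ1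

/-- ★★ **THE KNIT CERTIFICATE's «`Q(U)` onto» ROW** ((L6), dag-n06-l): `∀ α₀, 0 < α₀ → M·α₀ ≤ a → ∀ U, (3.35) → Q(U) surjective` at `G := SU(N)`, numerics
`c₀ ≤ 10`, `0 < α₀′ ≤ α_Q(d+1,L)`, `2(10La)(1+10La)e^{40La}·L⁴ < α₀′`, `K(d+1,L)·α₀′ < 1`.
[cite: Balaban1985BackgroundPropagators, p.420 («ω = (QGQ*)⁻¹B»), (3.35) p.396] [cite: Balaban1985Averaging, (139)–(147) pp.39–40] -/
theorem qKnitOfRecord_surjective_SU_thresh (x : MemberY θ.d₆ θ.ℓ₆ θ.hd' θ.hL' θ.b₀ θ.b₁ Mstar) {c₀ : ℝ} (hc : c₀ ≤ 10) {a α₀' : ℝ}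
    (hα' : 0 < α₀') (hαQ : α₀' ≤ alphaQ (θ.d₆ + 1) (θ.ℓ₆ + 1))
    (hKa : 2 * (10 * ((θ.ℓ₆ : ℝ) + 1) * a) * (1 + 10 * ((θ.ℓ₆ : ℝ) + 1) * a) * Real.exp (4 * (10 * ((θ.ℓ₆ : ℝ) + 1) * a)) * ((θ.ℓ₆ : ℝ) + 1) ^ 4 < α₀')
    (hsmall : kCol (θ.d₆ + 1) (θ.ℓ₆ + 1) * α₀' < 1) :
    ∀ α₀ : ℝ, 0 < α₀ → (geo9Y x).M * α₀ ≤ a → ∀ U : CfgY (Matrix (Fin N) (Fin N) ℂ) x.toKIdx,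
      (bg9YP (Matrix (Fin N) (Fin N) ℂ) (specialUnitaryUnits (Fin N)) x).Reg335 c₀ α₀ U → Function.Surjective (qKnitOfRecord N θ x.toKIdx U) :=
  fun _ hα₀ hMa _ hreg =>
    surjective_qKnitOfRecord_of_thresh unitBddY_specialUnitaryUnits specialUnitaryUnits_le_unitaryUnits hc x.toKIdx hα' hαQ
      (by rw [Kpl_mul_L4_eq θ Mstar x a]; exact hKa) hsmall hα₀.le hMa (regQY_of_reg335YP x hreg)

/-- ★★ **THE KNIT CERTIFICATE's «`Q†(U)` injective» ROW** (the injectivity half of its `hUQ`), same numerics.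
[cite: Balaban1985BackgroundPropagators, (3.128) p.421, p.393 (Q* the adjoint of Q), (3.35) p.396] [cite: Balaban1985Averaging, (139)–(147) pp.39–40] -/
theorem qsKnitOfRecord_injective_SU_thresh (x : MemberY θ.d₆ θ.ℓ₆ θ.hd' θ.hL' θ.b₀ θ.b₁ Mstar) {c₀ : ℝ} (hc : c₀ ≤ 10) {a α₀' : ℝ}
    (hα' : 0 < α₀') (hαQ : α₀' ≤ alphaQ (θ.d₆ + 1) (θ.ℓ₆ + 1))
    (hKa : 2 * (10 * ((θ.ℓ₆ : ℝ) + 1) * a) * (1 + 10 * ((θ.ℓ₆ : ℝ) + 1) * a) * Real.exp (4 * (10 * ((θ.ℓ₆ : ℝ) + 1) * a)) * ((θ.ℓ₆ : ℝ) + 1) ^ 4 < α₀')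
    (hsmall : kCol (θ.d₆ + 1) (θ.ℓ₆ + 1) * α₀' < 1) :
    ∀ α₀ : ℝ, 0 < α₀ → (geo9Y x).M * α₀ ≤ a → ∀ U : CfgY (Matrix (Fin N) (Fin N) ℂ) x.toKIdx,
      (bg9YP (Matrix (Fin N) (Fin N) ℂ) (specialUnitaryUnits (Fin N)) x).Reg335 c₀ α₀ U → Function.Injective (qsKnitOfRecord N θ x.toKIdx U) :=
  fun _ hα₀ hMa _ hreg =>
    injective_qsKnitOfRecord_of_thresh unitBddY_specialUnitaryUnits specialUnitaryUnits_le_unitaryUnits hc x.toKIdx hα' hαQ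
      (by rw [Kpl_mul_L4_eq θ Mstar x a]; exact hKa) hsmall hα₀.le hMa (regQY_of_reg335YP x hreg)

/-- ★★★ **THE KNIT CERTIFICATE's `hZ` ROW**: `∀ α₀, 0 < α₀ → M·α₀ ≤ a → ∀ U, (3.35) → Q(U) D_U G′_phys(U) R(U) = 0` for print's averaging of record over print's
knit transporter at `G := SU(N)` — the knit twin of the certificate's displayed `hZ` (there at `parSymY`), up to its unused `M₁₂ ≤ M` and `Reg336` antecedents;
numerics `c₀ ≤ 10`, `0 < α₀′`, `C₀α₀′ ≤ 1/3`, `2α₀′ ≤ c₂′`, `2(10La)(1+10La)e^{40La}·L⁴ < α₀′`.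
[cite: Balaban1985BackgroundPropagators, (3.115) p.418, (3.121) p.419, (3.122)–(3.125) p.420, (3.35) p.396] [cite: Balaban1985Averaging, Prop. 2 p.26] -/
theorem qKnitOfRecord_hZ_SU_thresh (x : MemberY θ.d₆ θ.ℓ₆ θ.hd' θ.hL' θ.b₀ θ.b₁ Mstar) {c₀ : ℝ} (hc : c₀ ≤ 10) {a α₀' : ℝ} (hα' : 0 < α₀')
    (hα3 : C0 (θ.d₆ + 1) * α₀' ≤ 1 / 3) (hα2 : 2 * α₀' ≤ c2' (θ.d₆ + 1) (θ.ℓ₆ + 1))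
    (hKa : 2 * (10 * ((θ.ℓ₆ : ℝ) + 1) * a) * (1 + 10 * ((θ.ℓ₆ : ℝ) + 1) * a) * Real.exp (4 * (10 * ((θ.ℓ₆ : ℝ) + 1) * a)) * ((θ.ℓ₆ : ℝ) + 1) ^ 4 < α₀') :
    ∀ α₀ : ℝ, 0 < α₀ → (geo9Y x).M * α₀ ≤ a → ∀ U : CfgY (Matrix (Fin N) (Fin N) ℂ) x.toKIdx,
      (bg9YP (Matrix (Fin N) (Fin N) ℂ) (specialUnitaryUnits (Fin N)) x).Reg335 c₀ α₀ U →
        qKnitOfRecord N θ x.toKIdx U ∘ₗ gradY x.toKIdx U ∘ₗ GpPhysY x.toKIdx (parKnitY x.toKIdx) U ∘ₗ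
          RY x.toKIdx (parKnitY x.toKIdx) (GpPhysY x.toKIdx (parKnitY x.toKIdx)) U = 0 :=
  fun _ hα₀ hMa _ hreg =>
    qKnitOfRecord_hZ_of_thresh unitBddY_specialUnitaryUnits specialUnitaryUnits_le_unitaryUnits hc x.toKIdx hα' hα3 hα2
      (by rw [Kpl_mul_L4_eq θ Mstar x a]; exact hKa) hα₀.le hMa (regQY_of_reg335YP x hreg)

/-- ★★★ **THE KNIT CERTIFICATE's (3.152) ∕ (3.124) ROW FROM (3.138)** for the v11 knit record's own `G₁` at `G := SU(N)` (any residual family `𝔯`; print's units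
`c_f η = 1`): `∀ α₀, 0 < α₀ → M·α₀ ≤ a → ∀ U, (3.35) → G₁⁻¹(U) a unit → (R D* G₁ = R G′ D*) ∧ (G₁ D R = D G′ R) ∧ (Q G₁ D R = 0) ∧ (R D* G₁ Q† = 0) ∧ (R D* G₁ D R = R)`;
numerics `c₀ ≤ 10`, `0 < α₀′`, `C₀α₀′ ≤ 1/3`, `2α₀′ ≤ c₂′`, `2(10La)(1+10La)e^{40La}·L⁴ < α₀′`.
[cite: Balaban1985BackgroundPropagators, (3.152) p.426, (3.124) p.420, (3.115) p.418, (3.138) p.423, (3.24)–(3.25) p.394, (3.35) p.396] [cite: Balaban1985Averaging, Prop. 2 p.26, (15) p.19] -/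
theorem lettersYOfRecordV11K_ids3152_SU_thresh (𝔯 : ResY N θ Mstar) (x : MemberY θ.d₆ θ.ℓ₆ θ.hd' θ.hL' θ.b₀ θ.b₁ Mstar) {c₀ : ℝ} (hc : c₀ ≤ 10)
    {a α₀' : ℝ} (hα' : 0 < α₀') (hα3 : C0 (θ.d₆ + 1) * α₀' ≤ 1 / 3) (hα2 : 2 * α₀' ≤ c2' (θ.d₆ + 1) (θ.ℓ₆ + 1))
    (hKa : 2 * (10 * ((θ.ℓ₆ : ℝ) + 1) * a) * (1 + 10 * ((θ.ℓ₆ : ℝ) + 1) * a) * Real.exp (4 * (10 * ((θ.ℓ₆ : ℝ) + 1) * a)) * ((θ.ℓ₆ : ℝ) + 1) ^ 4 < α₀')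
    (hcf : x.toKIdx.cf * etaS x.toKIdx = 1) :
    ∀ α₀ : ℝ, 0 < α₀ → (geo9Y x).M * α₀ ≤ a → ∀ U : CfgY (Matrix (Fin N) (Fin N) ℂ) x.toKIdx,
      (bg9YP (Matrix (Fin N) (Fin N) ℂ) (specialUnitaryUnits (Fin N)) x).Reg335 c₀ α₀ U →
        IsUnit (deltaOneQY x.toKIdx (qKnitOfRecord N θ x.toKIdx) (qsKnitOfRecord N θ x.toKIdx) (parKnitY x.toKIdx) (GpPhysY x.toKIdx (parKnitY x.toKIdx))
          (𝔯 x).Δ2 U) →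
        (RY x.toKIdx (parKnitY x.toKIdx) (GpPhysY x.toKIdx (parKnitY x.toKIdx)) U ∘ₗ divY x.toKIdx U ∘ₗ (lettersYOfRecordV11K N θ Mstar 𝔯 x).G₁ U
            = RY x.toKIdx (parKnitY x.toKIdx) (GpPhysY x.toKIdx (parKnitY x.toKIdx)) U ∘ₗ GpPhysY x.toKIdx (parKnitY x.toKIdx) U ∘ₗ divY x.toKIdx U
        ∧ (lettersYOfRecordV11K N θ Mstar 𝔯 x).G₁ U ∘ₗ gradY x.toKIdx U ∘ₗ RY x.toKIdx (parKnitY x.toKIdx) (GpPhysY x.toKIdx (parKnitY x.toKIdx)) U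
            = gradY x.toKIdx U ∘ₗ GpPhysY x.toKIdx (parKnitY x.toKIdx) U ∘ₗ RY x.toKIdx (parKnitY x.toKIdx) (GpPhysY x.toKIdx (parKnitY x.toKIdx)) U
        ∧ qKnitOfRecord N θ x.toKIdx U ∘ₗ (lettersYOfRecordV11K N θ Mstar 𝔯 x).G₁ U ∘ₗ gradY x.toKIdx U ∘ₗ
              RY x.toKIdx (parKnitY x.toKIdx) (GpPhysY x.toKIdx (parKnitY x.toKIdx)) U = 0
        ∧ RY x.toKIdx (parKnitY x.toKIdx) (GpPhysY x.toKIdx (parKnitY x.toKIdx)) U ∘ₗ divY x.toKIdx U ∘ₗ (lettersYOfRecordV11K N θ Mstar 𝔯 x).G₁ U ∘ₗ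
              qsKnitOfRecord N θ x.toKIdx U = 0
        ∧ RY x.toKIdx (parKnitY x.toKIdx) (GpPhysY x.toKIdx (parKnitY x.toKIdx)) U ∘ₗ divY x.toKIdx U ∘ₗ (lettersYOfRecordV11K N θ Mstar 𝔯 x).G₁ U ∘ₗ
              gradY x.toKIdx U ∘ₗ RY x.toKIdx (parKnitY x.toKIdx) (GpPhysY x.toKIdx (parKnitY x.toKIdx)) U
            = RY x.toKIdx (parKnitY x.toKIdx) (GpPhysY x.toKIdx (parKnitY x.toKIdx)) U) :=
  fun _ hα₀ hMa _ hreg hM1 =>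
    lettersYOfRecordV11K_ids3152_SU_of_regQY N θ Mstar 𝔯 hc x (kGeo_M_mul_nonneg x.toKIdx hα₀.le) hα' hα3 hα2
      (Kpl_mul_L4_lt_of_thresh x.toKIdx (by rw [Kpl_mul_L4_eq θ Mstar x a]; exact hKa) hα₀.le hMa) hcf (regQY_of_reg335YP x hreg) hM1

end AtRecordThresh

end Literature.MathematicalPhysics.QuantumFieldTheory.Balaban1983to89.Node00
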